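import Summits.Ventures.CertifiedArithmetic.LowPrec.DoubleRoundingProductSameQuantumStripLaw
import Summits.Ventures.CertifiedArithmetic.LowPrec.DoubleRoundingProductMatrix

/-!
# Double rounding of products, the precision strip with a FINER quantum: two slip families

HONEST FRAMING (venture CertifiedArithmetic / cell `pub-lowprec`): certified error envelopes and
provably optimal rounding/accumulation schemes for low-precision formats under stated cost models;
every table by two implementations; no hardware or vendor claims.

`DRMul φ ψ` (`fl_φ (fl_ψ (a·b)) = fl_φ (a·b)` for all data of `φ`; saturating RNE, subnormals
kept) is decided in the tree for embedded pairs (`F_φ ⊆ F_ψ`) with `P_ψ ≥ 2 P_φ`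
(`DoubleRoundingProductLaw.lean`, every `d = L_φ - L_ψ ≥ 0`), in the PRECISION STRIP
`P_φ + 1 ≤ P_ψ ≤ 2 P_φ - 1` at EQUAL quanta `d = 0`
(`DoubleRoundingProductSameQuantumStripLaw.lean`: innocuous iff `P_φ ≤ 3`), and NEGATIVELY for
every `1 ≤ d ≤ P_φ` whatever `P_ψ` (THEOREM N-mul-U, `DoubleRoundingProductUnderflow.lean`) and
for `P_φ ≥ 4` throughout the strip (THEOREM N-mul-S, `not_drMul_strip`,
`DoubleRoundingStripLaws.lean`).  What is left of the strip is `P_φ ∈ {2, 3}` with a FINER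
quantum `d ≥ 1`: the registers `(P_φ, P_ψ) = (2, 3), (3, 4), (3, 5)`.  This file settles
the first two NEGATIVELY at every `d` by two record-generic slip families (§1); the third —
innocuous iff `d ≥ 4` — is the subject of the fine-strip law (implementation A,
`code/enum/mul_strip_fine_law.py`; Lean side NEXT).

* §1 (W9) `not_drMul_fine_two_three`: `m_φ = 1`, `m_ψ = 2`, `d ≥ 3`, data `3·2^α`, `3·2^β` quanta
  of `φ` with `α + β + 4 = bias φ`: `a·b = 9/16·q` (`q = quantum φ`) `= 9·2^(d-4)·quantum ψ` is the
  MIDPOINT of the values `8·2^(d-4)` (even significand `100`) and `10·2^(d-4)` of `ψ` — tie to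
  even: `fl_ψ (a·b) = q/2 ↦ 0`, directly `fl_φ (9q/16) = q`.  (For `d ≤ 2` THEOREM N-mul-U.)
  (W21) `not_drMul_fine_three_four`: `m_φ = 2`, `m_ψ = 3`, `d ≥ 2`, data `3·2^α`, `7·2^β` with
  `α + β + 2 = bias φ`: `a·b = 21/8·q = 21·2^(d-3)·quantum ψ`, the midpoint of `20·2^(d-3)`
  (significand `1010`) and `22·2^(d-3)` — `fl_ψ (a·b) = 5q/2`, itself the midpoint of the
  SUBNORMAL pair `2q, 3q` of `φ`: `↦ 2q`, directly `fl_φ (21q/8) = 3q`.  A DOUBLE TIE: both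
  roundings are ties resolved to even, at every depth `d ≥ 2` at once.
* §2 the hypotheses as boolean tests at the canonical exponents (`α = 0`), soundness, deep
  pseudo-records at `d = 2, 3, 9, 12`, and the named `13 × 13` matrix: (W9) holds on no named pair
  (the only `P = 2` record, e2m1, is shallow); (W21) holds on exactly the `3` embedded cells
  e3m2 → e4m3 (`d = 5`), e3m2 → binary8p4 / binary8p4f (`d = 6`) — e.g. `3/16 · 7/8 = 21/128 ↦
  5/32 ↦ 1/8` in e4m3 then e3m2, directly `3/16` — recorded as failures by exhaustive search in
  `DOUBLE-ROUNDING-MUL.md` §1 and here instances of a law reaching every deeper e3m2-like source.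

Two implementations: A = `code/enum/mul_strip_fine_law.py` (stdlib `fractions`, two independent
RNE implementations; (W9)/(W21) replayed on pseudo-records at every `d ≤ 2P + 6`; brute force of
`DRMul` on six record shapes per `(P_φ, P_ψ, d)`, `P_φ ≤ 4`; the named cells) →
`certs/enum/DOUBLE-ROUNDING-MUL-STRIP-FINE.json`; B = the kernel (this file).  PLACEMENT —
KNOWN: with UNBOUNDED exponents double rounding of products is innocuous for `p₂ ≥ 2p₁`
[Figueroa1995, §3], fails at `p₂ = 2p₁ - 1` for `p₁ = 4` (the square `13²`) and — [Rump2016,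
Lemma 4.5, proof] — has NO counterexample for `p₁ ≤ 3`; so for `P_φ ≤ 3` every verdict on the
strip is a GRADUAL-UNDERFLOW phenomenon (our scale-free table `mulStripHit_eq_false_of_le_three`
says the same for every `p₁ < p₂ < 2p₁`): (W9) slips at `q/2`, (W21) on the subnormal pair
`2q, 3q`.  Harmful
double rounding of underflowing products through a register of EQUAL precision and wider range is
classical ([ShudoMuraoka2000, §3.2], x87); with gradual underflow [Roux2014, Table II] gives the
sufficient `e_min₂ ≤ 2 e_min₁` at `p₂ ≥ 2p₁` only.  We found no statement in print deciding which
narrow registers `p₁ < p₂ < 2p₁` with a finer quantum are harmful for the products of a small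
format with subnormals, nor the double-tie mechanism (W21) (searched 2026-08-21, both corpora: held
corpus hybrid + vector "double rounding multiplication intermediate precision p2 < 2p1 harmful
tie" — textbook rounding pages only; galaxy all stars "double rounding|rounding twice|twice
rounded" — Goldberg 1991, Rump 2016 (above), P1788 drafts, Riedy 2001; none on this strip).  NEW
here: two record-generic slip families closing the registers `(2,3)` and `(3,4)` at every finer
quantum for deep sources, kernel-checked.  No hardware or vendor claims.
-/

namespace Summit.Ventures.CertifiedArithmetic

open Literature.ComputerArithmetic.FloatingPoint
open Literature.ComputerArithmetic.FloatingPoint.Format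
open Literature.ComputerArithmetic.FloatingPoint.MiniFloat

/-! ## §1 The two slip families -/

/-- (W9) THE REGISTER `(P_φ, P_ψ) = (2, 3)` SLIPS AT EVERY FINER QUANTUM `d ≥ 3` — for every pair
of records: `m_φ = 1`, `m_ψ = 2`, `L_ψ + 3 ≤ L_φ`, data `a = 3·2^α`, `b = 3·2^β` quanta of `φ` in
range with `α + β + 4 = bias φ` (so `2^(α+β)·quantum φ = 1/16`) and `5·2^(d-3) ≤ M_ψ`
`⟹ ¬ DRMul φ ψ`: `a·b = 9q/16 = 9·2^(d-4)·quantum ψ` is the midpoint of the consecutive values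
`8·2^(d-4)` and `10·2^(d-4)` of `ψ` and the tie goes to the even significand:
`fl_ψ (a·b) = 2^(d-1)·quantum ψ = q/2`, and `fl_φ (q/2) = 0` (tie to even) while
`fl_φ (9q/16) = q`.  (`d ≤ 2`: THEOREM N-mul-U.) [this packet; cite: Figueroa1995, §3] -/
theorem not_drMul_fine_two_three {φ ψ : Format} (hq : ψ.qexp + 3 ≤ φ.qexp)
    (hm : φ.manBits = 1) (hmψ : ψ.manBits = 2) {α β : ℕ} (hαβ : α + β + 4 = φ.bias)
    (ha : 3 * 2 ^ α ≤ φ.maxScaled) (hb : 3 * 2 ^ β ≤ φ.maxScaled)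
    (hy : 5 * 2 ^ ((φ.qexp - ψ.qexp).toNat - 3) ≤ ψ.maxScaled) : ¬ DRMul φ ψ := by
  intro hD
  have hq0 := φ.quantum_pos
  have hq1 := ψ.quantum_pos
  have hm2 : 2 ^ φ.manBits = 2 := by rw [hm]; rfl
  have hm4 : 2 ^ (φ.manBits + 1) = 4 := by rw [hm]; rfl
  set d := (φ.qexp - ψ.qexp).toNat with hd'
  have hd3 : 3 ≤ d := by omega
  have hQ : φ.quantum = 2 ^ d * ψ.quantum := quantum_eq_two_pow_mul (by omega)
  -- data
  obtain ⟨a, ha'⟩ := exists_toRat_eq_natMul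
    (representable_mul_pow (φ := φ) (k := 3) (j := α) (by omega) ha)
  obtain ⟨b, hb'⟩ := exists_toRat_eq_natMul
    (representable_mul_pow (φ := φ) (k := 3) (j := β) (by omega) hb)
  -- the unit `2^α · 2^β · 16 · q = 1`
  have hone : (2 : ℚ) ^ (φ.manBits + (φ.bias - 1)) * φ.quantum = 1 :=
    two_pow_mul_quantum_eq_one (by omega)
  have e1 : φ.manBits + (φ.bias - 1) = α + β + 4 := by omega
  rw [e1, pow_add, pow_add] at hone
  have hunit : (2 : ℚ) ^ α * 2 ^ β * φ.quantum = 1 / 16 := by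
    rw [eq_div_iff (by norm_num), ← hone]; ring
  have hprod : ((3 * 2 ^ α : ℕ) : ℚ) * φ.quantum * (((3 * 2 ^ β : ℕ) : ℚ) * φ.quantum)
      = 9 / 16 * φ.quantum := by
    push_cast
    calc (3 : ℚ) * 2 ^ α * φ.quantum * (3 * 2 ^ β * φ.quantum)
        = 9 * ((2 : ℚ) ^ α * 2 ^ β * φ.quantum) * φ.quantum := by ring
      _ = 9 / 16 * φ.quantum := by rw [hunit]; ring
  -- the rounding in `ψ`: a tie at `9·2^(d-4)`, to the even side `8·2^(d-4) = q/2`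
  have hY : (roundNE ψ (9 / 16 * φ.quantum)).toRat = φ.quantum / 2 := by
    rcases Nat.lt_or_ge d 4 with hlt | hge
    · -- `d = 3`: `9/2` quanta of `ψ`, the midpoint of the values `4, 5`
      have hd3' : d = 3 := by omega
      rw [hd3'] at hQ
      have e : 9 / 16 * φ.quantum = ((2 * 4 + 1 : ℕ) : ℚ) / 2 * ψ.quantum := by
        rw [hQ]; push_cast; ring
      rw [e, toRat_roundNE_half_of_even (by omega) (j := 4) ⟨2, rfl⟩ (by rw [hmψ]; norm_num)
        (by rw [hd3'] at hy; simpa using hy), hQ]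
      push_cast; ring
    · -- `d ≥ 4`: the general midpoint `(2·4 + 1)·2^(d-4)`
      have hd2 : (2 : ℚ) ^ d = 16 * 2 ^ (d - 4) := by
        rw [← show (2 : ℚ) ^ 4 * 2 ^ (d - 4) = 2 ^ d by rw [← pow_add]; congr 1; omega]
        norm_num
      have e : 9 / 16 * φ.quantum = (((2 * 4 + 1) * 2 ^ (d - 4) : ℕ) : ℚ) * ψ.quantum := by
        rw [hQ, hd2]; push_cast; ring
      rw [e, toRat_roundNE_gmid (by omega) (t := 4) (k := d - 4) ⟨2, rfl⟩
        (by rw [hmψ]; norm_num) (by rw [hmψ]; norm_num)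
        (by rw [show d - 4 + 1 = d - 3 by omega]; exact hy), hQ, hd2,
        show d - 4 + 1 = d - 3 by omega]
      push_cast
      rw [show (2 : ℚ) ^ (d - 3) = 2 * 2 ^ (d - 4) by rw [← pow_succ']; congr 1; omega]
      ring
  -- the two roundings in `φ`
  have hM1 : 1 ≤ φ.maxScaled := by
    have : 1 ≤ 2 ^ β := Nat.one_le_two_pow
    omega
  have hX1 : (roundNE φ (φ.quantum / 2)).toRat = 0 := by
    have h := toRat_roundNE_half_of_even (φ := φ) (by omega) (j := 0) ⟨0, rfl⟩ (by omega) (by omega)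
    have e : φ.quantum / 2 = ((2 * 0 + 1 : ℕ) : ℚ) / 2 * φ.quantum := by push_cast; ring
    rw [e, h]; push_cast; ring
  have hX2 : (roundNE φ (9 / 16 * φ.quantum)).toRat = φ.quantum := by
    have hrep : φ.Representable 1 := representable_of_lt_pow (by omega) hM1
    have e : 9 / 16 * φ.quantum = ((1 : ℕ) : ℚ) * φ.quantum + (-(7 / 16 * φ.quantum)) := by
      push_cast; ring
    rw [e, toRat_roundNE_natMul_add_small hrep
      (by rw [abs_neg, abs_of_pos (by positivity)]; linarith)]
    push_cast; ring
  have key := hD a b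
  rw [ha', hb', hprod, hY, hX1, hX2] at key
  linarith

/-- (W21) THE REGISTER `(P_φ, P_ψ) = (3, 4)` SLIPS AT EVERY FINER QUANTUM `d ≥ 2` — for every pair
of records: `m_φ = 2`, `m_ψ = 3`, `L_ψ + 2 ≤ L_φ`, data `a = 3·2^α`, `b = 7·2^β` quanta of `φ` in
range with `α + β + 2 = bias φ` (so `2^(α+β)·quantum φ = 1/8`) and `11·2^(d-2) ≤ M_ψ`
`⟹ ¬ DRMul φ ψ` — a DOUBLE TIE: `a·b = 21q/8 = 21·2^(d-3)·quantum ψ` is the midpoint of the values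
`20·2^(d-3)` (significand `1010`) and `22·2^(d-3)` of `ψ`: `fl_ψ (a·b) = 5q/2`, the midpoint of
the subnormal pair `2q, 3q` of `φ`: `fl_φ (5q/2) = 2q`, while `fl_φ (21q/8) = 3q`.
(`d = 1`: THEOREM N-mul-U.) [this packet; cite: Figueroa1995, §3] -/
theorem not_drMul_fine_three_four {φ ψ : Format} (hq : ψ.qexp + 2 ≤ φ.qexp)
    (hm : φ.manBits = 2) (hmψ : ψ.manBits = 3) {α β : ℕ} (hαβ : α + β + 2 = φ.bias)
    (ha : 3 * 2 ^ α ≤ φ.maxScaled) (hb : 7 * 2 ^ β ≤ φ.maxScaled)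
    (hy : 11 * 2 ^ ((φ.qexp - ψ.qexp).toNat - 2) ≤ ψ.maxScaled) : ¬ DRMul φ ψ := by
  intro hD
  have hq0 := φ.quantum_pos
  have hq1 := ψ.quantum_pos
  have hm4 : 2 ^ φ.manBits = 4 := by rw [hm]; rfl
  have hm8 : 2 ^ (φ.manBits + 1) = 8 := by rw [hm]; rfl
  set d := (φ.qexp - ψ.qexp).toNat with hd'
  have hd2 : 2 ≤ d := by omega
  have hQ : φ.quantum = 2 ^ d * ψ.quantum := quantum_eq_two_pow_mul (by omega)
  -- data
  obtain ⟨a, ha'⟩ := exists_toRat_eq_natMul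
    (representable_mul_pow (φ := φ) (k := 3) (j := α) (by omega) ha)
  obtain ⟨b, hb'⟩ := exists_toRat_eq_natMul
    (representable_mul_pow (φ := φ) (k := 7) (j := β) (by omega) hb)
  -- the unit `2^α · 2^β · 8 · q = 1`
  have hone : (2 : ℚ) ^ (φ.manBits + (φ.bias - 1)) * φ.quantum = 1 :=
    two_pow_mul_quantum_eq_one (by omega)
  have e1 : φ.manBits + (φ.bias - 1) = α + β + 3 := by omega
  rw [e1, pow_add, pow_add] at hone
  have hunit : (2 : ℚ) ^ α * 2 ^ β * φ.quantum = 1 / 8 := by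
    rw [eq_div_iff (by norm_num), ← hone]; ring
  have hprod : ((3 * 2 ^ α : ℕ) : ℚ) * φ.quantum * (((7 * 2 ^ β : ℕ) : ℚ) * φ.quantum)
      = 21 / 8 * φ.quantum := by
    push_cast
    calc (3 : ℚ) * 2 ^ α * φ.quantum * (7 * 2 ^ β * φ.quantum)
        = 21 * ((2 : ℚ) ^ α * 2 ^ β * φ.quantum) * φ.quantum := by ring
      _ = 21 / 8 * φ.quantum := by rw [hunit]; ring
  -- the rounding in `ψ`: a tie at `21·2^(d-3)`, to the even side `20·2^(d-3) = 5q/2`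
  have hY : (roundNE ψ (21 / 8 * φ.quantum)).toRat = 5 / 2 * φ.quantum := by
    rcases Nat.lt_or_ge d 3 with hlt | hge
    · -- `d = 2`: `21/2` quanta of `ψ`, the midpoint of the values `10, 11`
      have hd2' : d = 2 := by omega
      rw [hd2'] at hQ
      have e : 21 / 8 * φ.quantum = ((2 * 10 + 1 : ℕ) : ℚ) / 2 * ψ.quantum := by
        rw [hQ]; push_cast; ring
      rw [e, toRat_roundNE_half_of_even (by omega) (j := 10) ⟨5, rfl⟩ (by rw [hmψ]; norm_num)
        (by rw [hd2'] at hy; simpa using hy), hQ]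
      push_cast; ring
    · -- `d ≥ 3`: the general midpoint `(2·10 + 1)·2^(d-3)`
      have hd3 : (2 : ℚ) ^ d = 8 * 2 ^ (d - 3) := by
        rw [← show (2 : ℚ) ^ 3 * 2 ^ (d - 3) = 2 ^ d by rw [← pow_add]; congr 1; omega]
        norm_num
      have e : 21 / 8 * φ.quantum = (((2 * 10 + 1) * 2 ^ (d - 3) : ℕ) : ℚ) * ψ.quantum := by
        rw [hQ, hd3]; push_cast; ring
      rw [e, toRat_roundNE_gmid (by omega) (t := 10) (k := d - 3) ⟨5, rfl⟩
        (by rw [hmψ]; norm_num) (by rw [hmψ]; norm_num)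
        (by rw [show d - 3 + 1 = d - 2 by omega]; exact hy), hQ, hd3,
        show d - 3 + 1 = d - 2 by omega]
      push_cast
      rw [show (2 : ℚ) ^ (d - 2) = 2 * 2 ^ (d - 3) by rw [← pow_succ']; congr 1; omega]
      ring
  -- the two roundings in `φ`: `5q/2 ↦ 2q` (tie, even subnormal), `21q/8 ↦ 3q`
  have hM3 : 3 ≤ φ.maxScaled := by
    have : 1 ≤ 2 ^ α := Nat.one_le_two_pow
    nlinarith
  have hX1 : (roundNE φ (5 / 2 * φ.quantum)).toRat = 2 * φ.quantum := by
    have h := toRat_roundNE_half_of_even (φ := φ) (by omega) (j := 2) ⟨1, rfl⟩ (by omega) hM3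
    have e : 5 / 2 * φ.quantum = ((2 * 2 + 1 : ℕ) : ℚ) / 2 * φ.quantum := by push_cast; ring
    rw [e, h]; push_cast; ring
  have hX2 : (roundNE φ (21 / 8 * φ.quantum)).toRat = 3 * φ.quantum := by
    have hrep : φ.Representable 3 := representable_of_lt_pow (by omega) hM3
    have e : 21 / 8 * φ.quantum = ((3 : ℕ) : ℚ) * φ.quantum + (-(3 / 8 * φ.quantum)) := by
      push_cast; ring
    rw [e, toRat_roundNE_natMul_add_small hrep
      (by rw [abs_neg, abs_of_pos (by positivity)]; linarith)]
    push_cast; ring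
  have key := hD a b
  rw [ha', hb', hprod, hY, hX1, hX2] at key
  linarith

/-! ## §2 The hypotheses as boolean tests; deep pseudo-records; the named records -/

/-- THE HYPOTHESIS OF (W9) AS A BOOLEAN TEST on parameter records, at the canonical exponents
`α = 0`, `β = bias_X - 4`. [this packet] -/
def drMulFine23Test (X Y : Format) : Bool :=
  let d := (X.qexp - Y.qexp).toNat
  decide (Y.qexp + 3 ≤ X.qexp) && decide (X.manBits = 1) && decide (Y.manBits = 2) &&
  decide (4 ≤ X.bias) && decide (3 * 2 ^ 0 ≤ X.maxScaled) &&
  decide (3 * 2 ^ (X.bias - 4) ≤ X.maxScaled) && decide (5 * 2 ^ (d - 3) ≤ Y.maxScaled)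

/-- SOUNDNESS: `drMulFine23Test X Y ⟹ ¬ DRMul X Y` ((W9) at `α = 0`). [this packet] -/
theorem not_drMul_of_fine23Test {X Y : Format} (h : drMulFine23Test X Y = true) :
    ¬ DRMul X Y := by
  simp only [drMulFine23Test, Bool.and_eq_true, decide_eq_true_eq] at h
  obtain ⟨⟨⟨⟨⟨⟨hq, hm⟩, hmψ⟩, hβ⟩, ha⟩, hb⟩, hy⟩ := h
  exact not_drMul_fine_two_three hq hm hmψ (α := 0) (β := X.bias - 4) (by omega) ha hb hy

/-- THE HYPOTHESIS OF (W21) AS A BOOLEAN TEST on parameter records, at the canonical exponents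
`α = 0`, `β = bias_X - 2`. [this packet] -/
def drMulFine34Test (X Y : Format) : Bool :=
  let d := (X.qexp - Y.qexp).toNat
  decide (Y.qexp + 2 ≤ X.qexp) && decide (X.manBits = 2) && decide (Y.manBits = 3) &&
  decide (2 ≤ X.bias) && decide (3 * 2 ^ 0 ≤ X.maxScaled) &&
  decide (7 * 2 ^ (X.bias - 2) ≤ X.maxScaled) && decide (11 * 2 ^ (d - 2) ≤ Y.maxScaled)

/-- SOUNDNESS: `drMulFine34Test X Y ⟹ ¬ DRMul X Y` ((W21) at `α = 0`). [this packet] -/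
theorem not_drMul_of_fine34Test {X Y : Format} (h : drMulFine34Test X Y = true) :
    ¬ DRMul X Y := by
  simp only [drMulFine34Test, Bool.and_eq_true, decide_eq_true_eq] at h
  obtain ⟨⟨⟨⟨⟨⟨hq, hm⟩, hmψ⟩, hβ⟩, ha⟩, hb⟩, hy⟩ := h
  exact not_drMul_fine_three_four hq hm hmψ (α := 0) (β := X.bias - 2) (by omega) ha hb hy

/-- A register for the deep `P = 2` source `Z2deep = ⟨1, 40, 81, 1⟩` (`L = -40`): `P = 3`, quantum
`3` binades finer (`L = -43`). -/
def R2fine3d3 : Format := ⟨2, 42, 100, 3, by decide⟩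
/-- Same source, `P = 3`, quantum `12` binades finer (`L = -52`). -/
def R2fine3d12 : Format := ⟨2, 51, 120, 3, by decide⟩
/-- A register for the deep `P = 3` source `Z3deep = ⟨2, 30, 60, 3⟩` (`L = -31`): `P = 4`,
quantum `2` binades finer (`L = -33`). -/
def R3fine4d2 : Format := ⟨3, 31, 80, 7, by decide⟩
/-- Same source, `P = 4`, quantum `9` binades finer (`L = -40`). -/
def R3fine4d9 : Format := ⟨3, 38, 90, 7, by decide⟩

/-- DEEP PSEUDO-RECORDS: the embedded registers `(2,3)` at `d = 3, 12` and `(3,4)` at `d = 2, 9`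
all slip. [this packet] -/
theorem not_drMul_fine_deep :
    (embedsTest Z2deep R2fine3d3 = true ∧ ¬ DRMul Z2deep R2fine3d3) ∧
    (embedsTest Z2deep R2fine3d12 = true ∧ ¬ DRMul Z2deep R2fine3d12) ∧
    (embedsTest Z3deep R3fine4d2 = true ∧ ¬ DRMul Z3deep R3fine4d2) ∧
    (embedsTest Z3deep R3fine4d9 = true ∧ ¬ DRMul Z3deep R3fine4d9) :=
  ⟨⟨by decide +kernel, not_drMul_of_fine23Test (by decide +kernel)⟩,
    ⟨by decide +kernel, not_drMul_of_fine23Test (by decide +kernel)⟩,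
    ⟨by decide +kernel, not_drMul_of_fine34Test (by decide +kernel)⟩,
    ⟨by decide +kernel, not_drMul_of_fine34Test (by decide +kernel)⟩⟩

/-- THE NAMED `13 × 13` MATRIX: (W9) holds on no named pair (e2m1, the only `P = 2` record, has
`bias = 1 < 4`); (W21) holds on exactly the `3` cells e3m2 → e4m3 (`d = 5`), e3m2 → binary8p4,
e3m2 → binary8p4f (`d = 6`). [this packet] -/
theorem drMulFine_named_iff : ∀ X ∈ namedFormats, ∀ Y ∈ namedFormats,
    drMulFine23Test X Y = false ∧
    (drMulFine34Test X Y = true ↔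
      (X, Y) ∈ [(E3M2, E4M3), (E3M2, Binary8p4), (E3M2, Binary8p4F)]) := by
  decide +kernel

/-- THE `3` NAMED CELLS FAIL BY THE LAW, and all three are embedded pairs: e.g. in e4m3,
`3/16 · 7/8 = 21/128 = 84·2^-9 ↦ 80·2^-9 = 5/32` (tie, even significand `1010`), then in e3m2
`5/32 = 5q/2 ↦ 2q = 1/8` (tie, even), directly `fl_e3m2 (21/128) = 3/16`. [this packet] -/
theorem drMulFine_cells : ∀ p ∈ [(E3M2, E4M3), (E3M2, Binary8p4), (E3M2, Binary8p4F)],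
    ¬ DRMul p.1 p.2 ∧ embedsTest p.1 p.2 = true := by
  intro p hp
  simp only [List.mem_cons, List.not_mem_nil, or_false] at hp
  rcases hp with rfl | rfl | rfl
  all_goals exact ⟨not_drMul_of_fine34Test (by decide +kernel), by decide +kernel⟩

end Summit.Ventures.CertifiedArithmetic
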